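import Mathlib
import Literature.Geometry.Riemannian.SphericalCylinderEntropy
import Literature.Geometry.Manifold.CylinderSlice
import HarnessLib

/-!
# Radial domination of the cylinder heat kernel by an antitone profile

Stub `stub_kernelDomination` of line `ball-mass-slack` of the crux `CylinderEntropy.ThinCrossSectionExists`
(`stmt-SmoothPoincare4-7633`), proved with its registered statement verbatim.

From the two monotonicity hypotheses
* (A) `θ ↦ zonal τ (cos θ) · exp (θ² / 4τ)` is non-decreasing on `[0, π]`,
* (B) `zonal τ` is non-decreasing on `[-1, 1]`,
we build, for every `τ > 0`, the explicit radial profile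
`F r = max 0 (zonal τ (cos θ⋆) · exp ((θ⋆² - (max r 0)²) / 4τ))`, `θ⋆ = min (max r 0) π`,
and prove: `F` is antitone on `ℝ` (it equals `max 0 (zonal τ (cos (max r 0)))` on `(-∞, π]`, antitone by
(B) and `Real.cos_le_cos_of_nonneg_of_le_pi`, and `max 0 (zonal τ (-1) · exp ((π² - r²)/4τ))` on `[π, ∞)`,
antitone by a sign discussion; glued with `AntitoneOn.Iic_union_Ici`), non-negative, dominates the typed
kernel `cylKernel p τ y = zonal τ ⟨y', p'⟩ · exp (-(y₅ - p₅)²/4τ)` (`cylKernel_eq`, `abs_sum_mul_le_one`,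
`Real.cos_arccos`, hypothesis (A) multiplied by the positive factor `exp (-r²/4τ)`), and is dominated by the
kernel on the central slice seen from `e₀ = EuclideanSpace.single 0 1` (there the intrinsic distance is
`arccos y₀` and both sides reduce to `zonal τ y₀`, up to `max 0 ·`, removed by `ENNReal.ofReal_of_nonpos`).

Everything here is proved; no facts and no `Prop`-valued definitions are introduced: the profile is an
explicit `fun` term and the helper lemmas are stated for an arbitrary `F` satisfying its defining equation.
-/

noncomputable section

open scoped BigOperators Topology MeasureTheory ENNReal NNReal
open Set Function MeasureTheory
open Literature.Geometry.Riemannian.SphericalCylinderEntropy (cylEntropy cylDensity cylKernel zonal wt gegen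
  cylKernel_eq abs_sum_mul_le_one hausdorffMeasure_sphere_four_pos hausdorffMeasure_sphere_four_lt_top)
open Literature.Geometry.Manifold.CylinderSlice (sliceMap range_sliceMap)

set_option linter.dupNamespace false

namespace Summit.SmoothPoincare4.SmoothPoincare4.Theorems.ThinCrossSectionExists.BallMassSlack

namespace KernelDomination

/-- Below `π` the profile is `max 0 (zonal τ (cos (max r 0)))`. [folklore] -/
theorem profile_eq_of_le_pi {τ : ℝ} {F : ℝ → ℝ}
    (hF : ∀ r, F r = max 0 (zonal τ (Real.cos (min (max r 0) Real.pi)) *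
      Real.exp (((min (max r 0) Real.pi) ^ 2 - (max r 0) ^ 2) / (4 * τ))))
    {r : ℝ} (hr : r ≤ Real.pi) : F r = max 0 (zonal τ (Real.cos (max r 0))) := by
  have h1 : min (max r 0) Real.pi = max r 0 := min_eq_left (max_le hr Real.pi_pos.le)
  rw [hF, h1, sub_self, zero_div, Real.exp_zero, mul_one]

/-- Above `π` the profile is `max 0 (zonal τ (-1) · exp ((π² - r²) / 4τ))`. [folklore] -/
theorem profile_eq_of_pi_le {τ : ℝ} {F : ℝ → ℝ}
    (hF : ∀ r, F r = max 0 (zonal τ (Real.cos (min (max r 0) Real.pi)) *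
      Real.exp (((min (max r 0) Real.pi) ^ 2 - (max r 0) ^ 2) / (4 * τ))))
    {r : ℝ} (hr : Real.pi ≤ r) :
    F r = max 0 (zonal τ (-1) * Real.exp ((Real.pi ^ 2 - r ^ 2) / (4 * τ))) := by
  have h0 : max r 0 = r := max_eq_left (Real.pi_pos.le.trans hr)
  have h1 : min (max r 0) Real.pi = Real.pi := by rw [h0]; exact min_eq_right hr
  rw [hF, h1, h0, Real.cos_pi]

/-- The profile is antitone on `(-∞, π]`, by (B) and the monotonicity of `cos` on `[0, π]`. [folklore] -/
theorem profile_antitoneOn_Iic {τ : ℝ} {F : ℝ → ℝ} (hB : MonotoneOn (zonal τ) (Icc (-1) 1))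
    (hF : ∀ r, F r = max 0 (zonal τ (Real.cos (min (max r 0) Real.pi)) *
      Real.exp (((min (max r 0) Real.pi) ^ 2 - (max r 0) ^ 2) / (4 * τ)))) :
    AntitoneOn F (Iic Real.pi) := by
  intro a ha b hb hab
  rw [profile_eq_of_le_pi hF (show a ≤ Real.pi from ha),
    profile_eq_of_le_pi hF (show b ≤ Real.pi from hb)]
  refine max_le_max le_rfl (hB ⟨Real.neg_one_le_cos _, Real.cos_le_one _⟩
    ⟨Real.neg_one_le_cos _, Real.cos_le_one _⟩ ?_)
  exact Real.cos_le_cos_of_nonneg_of_le_pi (le_max_right a 0) (max_le hb Real.pi_pos.le)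
    (max_le_max hab le_rfl)

/-- The profile is antitone on `[π, ∞)` (sign discussion on `zonal τ (-1)`). [folklore] -/
theorem profile_antitoneOn_Ici {τ : ℝ} {F : ℝ → ℝ} (hτ : 0 < τ)
    (hF : ∀ r, F r = max 0 (zonal τ (Real.cos (min (max r 0) Real.pi)) *
      Real.exp (((min (max r 0) Real.pi) ^ 2 - (max r 0) ^ 2) / (4 * τ)))) :
    AntitoneOn F (Ici Real.pi) := by
  intro a ha b hb hab
  have ha' : Real.pi ≤ a := ha
  have hb' : Real.pi ≤ b := hb
  rw [profile_eq_of_pi_le hF ha', profile_eq_of_pi_le hF hb']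
  rcases le_or_gt 0 (zonal τ (-1)) with h0 | h0
  · refine max_le_max le_rfl (mul_le_mul_of_nonneg_left ?_ h0)
    refine Real.exp_le_exp.mpr (div_le_div_of_nonneg_right ?_ (by positivity))
    nlinarith [Real.pi_pos, mul_le_mul hab hab (Real.pi_pos.le.trans ha') (Real.pi_pos.le.trans hb')]
  · have hb0 : zonal τ (-1) * Real.exp ((Real.pi ^ 2 - b ^ 2) / (4 * τ)) ≤ 0 :=
      mul_nonpos_of_nonpos_of_nonneg h0.le (Real.exp_nonneg _)
    rw [max_eq_left hb0]
    exact le_max_left _ _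

/-- The profile is antitone on `ℝ`. [folklore] -/
theorem profile_antitone {τ : ℝ} {F : ℝ → ℝ} (hτ : 0 < τ) (hB : MonotoneOn (zonal τ) (Icc (-1) 1))
    (hF : ∀ r, F r = max 0 (zonal τ (Real.cos (min (max r 0) Real.pi)) *
      Real.exp (((min (max r 0) Real.pi) ^ 2 - (max r 0) ^ 2) / (4 * τ)))) :
    Antitone F :=
  (profile_antitoneOn_Iic hB hF).Iic_union_Ici (profile_antitoneOn_Ici hτ hF)

/-- **Domination**: on `N`, `cylKernel p τ y ≤ F (d_N(y, p))`, by (A) between `θ = arccos ⟨y', p'⟩` and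
`θ⋆ = min r π ≥ θ`, multiplied by `exp (-r² / 4τ)`, `r = d_N(y, p)`. [folklore] -/
theorem profile_dominates {τ : ℝ} {F : ℝ → ℝ}
    (hA : MonotoneOn (fun θ : ℝ => zonal τ (Real.cos θ) * Real.exp (θ ^ 2 / (4 * τ))) (Icc 0 Real.pi))
    (hF : ∀ r, F r = max 0 (zonal τ (Real.cos (min (max r 0) Real.pi)) *
      Real.exp (((min (max r 0) Real.pi) ^ 2 - (max r 0) ^ 2) / (4 * τ))))
    (p y : EuclideanSpace ℝ (Fin 6)) (hp : ∑ i : Fin 5, p (Fin.castSucc i) ^ 2 = 1)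
    (hy : ∑ i : Fin 5, y (Fin.castSucc i) ^ 2 = 1) :
    cylKernel p τ y ≤
      F (Real.sqrt (Real.arccos (∑ i : Fin 5, y (Fin.castSucc i) * p (Fin.castSucc i)) ^ 2 +
        (y 5 - p 5) ^ 2)) := by
  rw [cylKernel_eq]
  have hc1 := abs_sum_mul_le_one hy hp
  set c : ℝ := ∑ i : Fin 5, y (Fin.castSucc i) * p (Fin.castSucc i) with hc
  set θ : ℝ := Real.arccos c with hθ
  set Δ : ℝ := y 5 - p 5 with hΔ
  set r : ℝ := Real.sqrt (θ ^ 2 + Δ ^ 2) with hr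
  have hθ0 : 0 ≤ θ := Real.arccos_nonneg c
  have hθπ : θ ≤ Real.pi := Real.arccos_le_pi c
  have hr0 : 0 ≤ r := Real.sqrt_nonneg _
  have hθr : θ ≤ r := by
    calc θ = Real.sqrt (θ ^ 2) := (Real.sqrt_sq hθ0).symm
      _ ≤ Real.sqrt (θ ^ 2 + Δ ^ 2) := Real.sqrt_le_sqrt (le_add_of_nonneg_right (sq_nonneg Δ))
  have hr2 : r ^ 2 = θ ^ 2 + Δ ^ 2 := Real.sq_sqrt (by positivity)
  have hmax : max r 0 = r := max_eq_left hr0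
  have hθ'0 : 0 ≤ min r Real.pi := le_min hr0 Real.pi_pos.le
  have hθ'π : min r Real.pi ≤ Real.pi := min_le_right _ _
  have hθθ' : θ ≤ min r Real.pi := le_min hθr hθπ
  have hAineq := hA ⟨hθ0, hθπ⟩ ⟨hθ'0, hθ'π⟩ hθθ'
  simp only at hAineq
  have hcos : Real.cos θ = c := Real.cos_arccos (abs_le.mp hc1).1 (abs_le.mp hc1).2
  rw [hF, hmax]
  refine le_trans ?_ (le_max_right _ _)
  have key : zonal τ c * Real.exp (-(Δ ^ 2) / (4 * τ)) =
      (zonal τ (Real.cos θ) * Real.exp (θ ^ 2 / (4 * τ))) * Real.exp (-(r ^ 2) / (4 * τ)) := by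
    rw [hcos, mul_assoc, ← Real.exp_add, hr2]
    congr 2
    ring
  have key2 : zonal τ (Real.cos (min r Real.pi)) *
        Real.exp (((min r Real.pi) ^ 2 - r ^ 2) / (4 * τ)) =
      (zonal τ (Real.cos (min r Real.pi)) * Real.exp ((min r Real.pi) ^ 2 / (4 * τ))) *
        Real.exp (-(r ^ 2) / (4 * τ)) := by
    rw [mul_assoc, ← Real.exp_add]
    congr 2
    ring
  rw [key, key2]
  exact mul_le_mul_of_nonneg_right hAineq (Real.exp_nonneg _)

/-- The base inner product with `e₀ = EuclideanSpace.single 0 1` is the first coordinate. [folklore] -/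
theorem sum_mul_single_zero (y : EuclideanSpace ℝ (Fin 6)) :
    ∑ i : Fin 5, y (Fin.castSucc i) * (EuclideanSpace.single 0 1 : EuclideanSpace ℝ (Fin 6)) (Fin.castSucc i)
      = y 0 := by
  simp

/-- The height of `e₀ = EuclideanSpace.single 0 1` vanishes. [folklore] -/
theorem single_zero_apply_five : (EuclideanSpace.single 0 1 : EuclideanSpace ℝ (Fin 6)) 5 = 0 := by
  simp

/-- A coordinate of a point of `N` lies in `[-1, 1]`. [folklore] -/
theorem abs_apply_zero_le_one {y : EuclideanSpace ℝ (Fin 6)} (hy : ∑ i : Fin 5, y (Fin.castSucc i) ^ 2 = 1) :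
    |y 0| ≤ 1 := by
  rw [← sq_le_one_iff_abs_le_one, ← hy]
  have h := Finset.single_le_sum (f := fun i : Fin 5 => y (Fin.castSucc i) ^ 2)
    (fun i _ => sq_nonneg (y (Fin.castSucc i))) (Finset.mem_univ (0 : Fin 5))
  simpa using h

/-- **Exactness on the central slice**: for `y ∈ N` with `y₅ = 0`, `ofReal (F (d_N(y, e₀))) ≤ ofReal
(cylKernel e₀ τ y)` (both equal `zonal τ y₀` up to `max 0 ·`). [folklore] -/
theorem profile_exact {τ : ℝ} {F : ℝ → ℝ}
    (hF : ∀ r, F r = max 0 (zonal τ (Real.cos (min (max r 0) Real.pi)) *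
      Real.exp (((min (max r 0) Real.pi) ^ 2 - (max r 0) ^ 2) / (4 * τ))))
    (y : EuclideanSpace ℝ (Fin 6)) (hy : ∑ i : Fin 5, y (Fin.castSucc i) ^ 2 = 1) (hy5 : y 5 = 0) :
    ENNReal.ofReal (F (Real.sqrt (Real.arccos (∑ i : Fin 5, y (Fin.castSucc i) *
        (EuclideanSpace.single 0 1 : EuclideanSpace ℝ (Fin 6)) (Fin.castSucc i)) ^ 2 +
        (y 5 - (EuclideanSpace.single 0 1 : EuclideanSpace ℝ (Fin 6)) 5) ^ 2))) ≤
      ENNReal.ofReal (cylKernel (EuclideanSpace.single 0 1 : EuclideanSpace ℝ (Fin 6)) τ y) := by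
  rw [cylKernel_eq, sum_mul_single_zero, single_zero_apply_five, hy5, sub_self,
    zero_pow two_ne_zero, add_zero, neg_zero, zero_div, Real.exp_zero, mul_one,
    Real.sqrt_sq (Real.arccos_nonneg _), profile_eq_of_le_pi hF (Real.arccos_le_pi _),
    max_eq_left (Real.arccos_nonneg _)]
  have h1 := abs_apply_zero_le_one hy
  rw [Real.cos_arccos (abs_le.mp h1).1 (abs_le.mp h1).2]
  rcases le_total 0 (zonal τ (y 0)) with h | h
  · rw [max_eq_right h]
  · rw [max_eq_left h, ENNReal.ofReal_zero, ENNReal.ofReal_of_nonpos h]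

end KernelDomination

/-- **Kernel domination** (stub `C-dom` of line `ball-mass-slack`): from the radial Harnack monotonicity (A)
and the zonal monotonicity (B), for every `τ > 0` there is an antitone non-negative radial profile `F`
dominating `cylKernel p τ ·` on `N` in the intrinsic distance and dominated by `cylKernel e₀ τ ·` on the
central slice. [folklore] -/
theorem stub_kernelDomination :
    (∀ τ : ℝ, 0 < τ →
        MonotoneOn (fun θ : ℝ => zonal τ (Real.cos θ) * Real.exp (θ ^ 2 / (4 * τ))) (Set.Icc 0 Real.pi)) →
    (∀ τ : ℝ, 0 < τ → MonotoneOn (zonal τ) (Set.Icc (-1) 1)) →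
      ∀ τ : ℝ, 0 < τ → ∃ F : ℝ → ℝ, Antitone F ∧ (∀ r : ℝ, 0 ≤ F r) ∧
        (∀ p y : EuclideanSpace ℝ (Fin 6), ∑ i : Fin 5, p (Fin.castSucc i) ^ 2 = 1 → ∑ i : Fin 5, y (Fin.castSucc i) ^ 2 = 1 →
            cylKernel p τ y ≤ F (Real.sqrt (Real.arccos (∑ i : Fin 5, y (Fin.castSucc i) * p (Fin.castSucc i)) ^ 2 + (y 5 - p 5) ^ 2))) ∧
        (∀ y : EuclideanSpace ℝ (Fin 6), ∑ i : Fin 5, y (Fin.castSucc i) ^ 2 = 1 → y 5 = 0 →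
            ENNReal.ofReal (F (Real.sqrt (Real.arccos (∑ i : Fin 5, y (Fin.castSucc i) * (EuclideanSpace.single 0 1 : EuclideanSpace ℝ (Fin 6)) (Fin.castSucc i)) ^ 2 + (y 5 - (EuclideanSpace.single 0 1 : EuclideanSpace ℝ (Fin 6)) 5) ^ 2))) ≤
              ENNReal.ofReal (cylKernel (EuclideanSpace.single 0 1 : EuclideanSpace ℝ (Fin 6)) τ y)) := by
  intro hA hB τ hτ
  refine ⟨fun r => max 0 (zonal τ (Real.cos (min (max r 0) Real.pi)) *
      Real.exp (((min (max r 0) Real.pi) ^ 2 - (max r 0) ^ 2) / (4 * τ))), ?_, fun r => le_max_left _ _,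
    ?_, ?_⟩
  · exact KernelDomination.profile_antitone hτ (hB τ hτ) (fun r => rfl)
  · exact fun p y hp hy => KernelDomination.profile_dominates (hA τ hτ) (fun r => rfl) p y hp hy
  · exact fun y hy hy5 => KernelDomination.profile_exact (fun r => rfl) y hy hy5

end Summit.SmoothPoincare4.SmoothPoincare4.Theorems.ThinCrossSectionExists.BallMassSlack

end
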